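import Mathlib

/-!
# Welch / Frobenius bound for the coset sums of the crux `CosetDecorrelation` (line `SketchIdeator3`)

Stub `stub_welchBound` of line `SketchIdeator3` of crux stmt-Parity-13317
(`Summit.Parity.GeneralizedHardyLittlewood.Theses.LiouvilleMAD.CosetDecorrelation`,
card `farey-level-mean-coupling`); Mathlib only; source for Welch's bound: Welch 1974
doi:10.1109/TIT.1974.1055219 (here only the elementary Frobenius `≥ trace²/rank` step).

**What is proved.**  For GENERAL real row weights `F n m`, a finite family of rows `n ∈ 𝒩`, a dyadic
block `m ∈ (M, 2M]` and a modulus `j ≥ 1`, put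
`A n a = Σ_{m ∈ (M,2M], m ≡ a (mod j)} F n m` (class-sum profile on `ℤ/j`),
`V_n = Σ_{a<j} (A n a)²` (class variance) and
`T_j(n,n') = Σ_{(m,m') ∈ (M,2M]², m ≡ m' (mod j)} F n m · F n' m'` (coset sum).  Then

`(Σ_{n∈𝒩} V_n)² ≤ j · Σ_{n,n'∈𝒩} T_j(n,n')²`.

**Proof sketch.**
* `welch_coset_eq_classInner` (class fibration): `T_j(n,n') = Σ_{a<j} A n a · A n' a` — fibre the
  pair filter by `p.1 % j` (`Finset.sum_fiberwise_of_maps_to`); for `a < j`,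
  `m ≡ a [MOD j] ↔ m % j = a`.
* `welch_frobenius_trace_sq_le` (pure algebra, the Gram matrix `G = 𝔸𝔸ᵀ` has `‖G‖_F² ≥ (tr G)²/j`):
  `Σ_{n,n'} (Σ_a A n a · A n' a)² = Σ_a Σ_b (Σ_n A n a · A n b)²` (`welch_gram_sq_sum_comm`,
  expand both squares and commute the four sums) `≥ Σ_a (Σ_n (A n a)²)²` (drop the `b ≠ a` squares)
  `≥ (Σ_a Σ_n (A n a)²)² / j` (Cauchy–Schwarz with weights `1` on `range j`,
  `Finset.sum_mul_sq_le_sq_mul_sq`).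
* `stub_welchBound`: specialise `A` and rewrite each `T_j(n,n')` by the class fibration.
-/

namespace Summit.Parity.GeneralizedHardyLittlewood.Theorems.CosetDecorrelation.FareyLevelMeanCoupling

open Finset

/-- Rearrangement of the squared Gram sum: `Σ_{n,n'} (Σ_a A n a · A n' a)² = Σ_a Σ_b (Σ_n A n a · A n b)²`
(expand both squares into fourfold sums and commute the summations). [folklore] -/
theorem welch_gram_sq_sum_comm (A : ℕ → ℕ → ℝ) (𝒩 : Finset ℕ) (j : ℕ) :
    ∑ n ∈ 𝒩, ∑ n' ∈ 𝒩, (∑ a ∈ Finset.range j, A n a * A n' a) ^ 2 =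
      ∑ a ∈ Finset.range j, ∑ b ∈ Finset.range j, (∑ n ∈ 𝒩, A n a * A n b) ^ 2 := by
  calc ∑ n ∈ 𝒩, ∑ n' ∈ 𝒩, (∑ a ∈ range j, A n a * A n' a) ^ 2
      = ∑ n ∈ 𝒩, ∑ n' ∈ 𝒩, ∑ a ∈ range j, ∑ b ∈ range j,
          (A n a * A n' a) * (A n b * A n' b) := by
        refine sum_congr rfl fun n _ => sum_congr rfl fun n' _ => ?_
        rw [sq, sum_mul_sum]
    _ = ∑ n ∈ 𝒩, ∑ a ∈ range j, ∑ n' ∈ 𝒩, ∑ b ∈ range j,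
          (A n a * A n' a) * (A n b * A n' b) := by
        refine sum_congr rfl fun n _ => ?_
        exact sum_comm
    _ = ∑ n ∈ 𝒩, ∑ a ∈ range j, ∑ b ∈ range j, ∑ n' ∈ 𝒩,
          (A n a * A n' a) * (A n b * A n' b) := by
        refine sum_congr rfl fun n _ => sum_congr rfl fun a _ => ?_
        exact sum_comm
    _ = ∑ a ∈ range j, ∑ n ∈ 𝒩, ∑ b ∈ range j, ∑ n' ∈ 𝒩,
          (A n a * A n' a) * (A n b * A n' b) := sum_comm
    _ = ∑ a ∈ range j, ∑ b ∈ range j, ∑ n ∈ 𝒩, ∑ n' ∈ 𝒩,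
          (A n a * A n' a) * (A n b * A n' b) := by
        refine sum_congr rfl fun a _ => ?_
        exact sum_comm
    _ = ∑ a ∈ range j, ∑ b ∈ range j, (∑ n ∈ 𝒩, A n a * A n b) ^ 2 := by
        refine sum_congr rfl fun a _ => sum_congr rfl fun b _ => ?_
        rw [sq, sum_mul_sum]
        refine sum_congr rfl fun n _ => sum_congr rfl fun n' _ => ?_
        ring

/-- FROBENIUS / WELCH step (pure algebra): for any family of real profiles `A n : ℕ → ℝ` on
`range j` and any finite `𝒩`, `(Σ_{n∈𝒩} Σ_{a<j} (A n a)²)² ≤ j · Σ_{n,n'∈𝒩} (Σ_{a<j} A n a · A n' a)²`,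
i.e. `(tr G)² ≤ j · ‖G‖_F²` for the Gram matrix `G = (⟨A n, A n'⟩)_{n,n'}` of rank `≤ j`:
`‖G‖_F² = Σ_{a,b} (Σ_n A n a · A n b)² ≥ Σ_a (Σ_n (A n a)²)² ≥ (Σ_a Σ_n (A n a)²)²/j`
(diagonal terms, then Cauchy–Schwarz on `range j`). [folklore; Welch 1974] -/
theorem welch_frobenius_trace_sq_le (A : ℕ → ℕ → ℝ) (𝒩 : Finset ℕ) (j : ℕ) :
    (∑ n ∈ 𝒩, ∑ a ∈ Finset.range j, A n a ^ 2) ^ 2 ≤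
      (j : ℝ) * ∑ n ∈ 𝒩, ∑ n' ∈ 𝒩, (∑ a ∈ Finset.range j, A n a * A n' a) ^ 2 := by
  rw [welch_gram_sq_sum_comm, sum_comm]
  -- diagonal terms: `Σ_a (Σ_n (A n a)²)² ≤ Σ_a Σ_b (Σ_n A n a · A n b)²`
  have hdiag : ∑ a ∈ range j, (∑ n ∈ 𝒩, A n a ^ 2) ^ 2 ≤
      ∑ a ∈ range j, ∑ b ∈ range j, (∑ n ∈ 𝒩, A n a * A n b) ^ 2 := by
    refine sum_le_sum fun a ha => ?_
    calc (∑ n ∈ 𝒩, A n a ^ 2) ^ 2 = (∑ n ∈ 𝒩, A n a * A n a) ^ 2 := by simp only [sq]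
      _ ≤ ∑ b ∈ range j, (∑ n ∈ 𝒩, A n a * A n b) ^ 2 :=
        single_le_sum (f := fun b => (∑ n ∈ 𝒩, A n a * A n b) ^ 2)
          (fun b _ => sq_nonneg _) ha
  -- Cauchy–Schwarz with weights `1` on `range j`: `(Σ_a x_a)² ≤ j · Σ_a x_a²`
  have hCS : (∑ a ∈ range j, ∑ n ∈ 𝒩, A n a ^ 2) ^ 2 ≤
      (j : ℝ) * ∑ a ∈ range j, (∑ n ∈ 𝒩, A n a ^ 2) ^ 2 := by
    have h := sum_mul_sq_le_sq_mul_sq (range j) (fun _ => (1 : ℝ)) (fun a => ∑ n ∈ 𝒩, A n a ^ 2)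
    simpa using h
  exact hCS.trans (mul_le_mul_of_nonneg_left hdiag (Nat.cast_nonneg j))

/-- CLASS FIBRATION (general weights): the coset sum over the pairs `(m, m') ∈ (M,2M]²` with
`m ≡ m' (mod j)`, `j ≥ 1`, is the inner product over `ℤ/j` of the two class-sum profiles,
`Σ_{m ≡ m' (j)} f m · g m' = Σ_{a<j} (Σ_{m ≡ a (j)} f m) · (Σ_{m ≡ a (j)} g m)`
(fibre the pair filter by `p.1 % j`; for `a < j`, `m ≡ a [MOD j] ↔ m % j = a`).  Private duplicate of
the neighbour's `normalForm_coset_eq_classInner` (this file imports Mathlib only). [folklore] -/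
private theorem welch_coset_eq_classInner (f g : ℕ → ℝ) (M j : ℕ) (hj : 1 ≤ j) :
    (∑ p ∈ (Finset.Ioc M (2 * M) ×ˢ Finset.Ioc M (2 * M)).filter
        (fun p : ℕ × ℕ => p.1 ≡ p.2 [MOD j]), f p.1 * g p.2) =
      ∑ a ∈ Finset.range j,
        (∑ m ∈ (Finset.Ioc M (2 * M)).filter (fun m => m ≡ a [MOD j]), f m) *
          (∑ m ∈ (Finset.Ioc M (2 * M)).filter (fun m => m ≡ a [MOD j]), g m) := by
  -- adapted from `cosetAsClassInnerProduct_holds` (Cruxes/CosetDecorrelation/SketchIdeator3.lean)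
  have key : ∀ a ∈ range j,
      ((Ioc M (2 * M)).filter (fun m => m ≡ a [MOD j])) ×ˢ
          ((Ioc M (2 * M)).filter (fun m => m ≡ a [MOD j]))
        = (((Ioc M (2 * M) ×ˢ Ioc M (2 * M)).filter (fun p : ℕ × ℕ => p.1 ≡ p.2 [MOD j])).filter
            (fun p : ℕ × ℕ => p.1 % j = a)) := by
    intro a ha
    have ha' : a % j = a := Nat.mod_eq_of_lt (mem_range.mp ha)
    ext ⟨m, m'⟩
    simp only [mem_product, mem_filter, Nat.ModEq]
    constructor
    · rintro ⟨⟨hm, hma⟩, ⟨hm', hm'a⟩⟩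
      refine ⟨⟨⟨hm, hm'⟩, ?_⟩, ?_⟩
      · rw [hma, hm'a]
      · rw [hma, ha']
    · rintro ⟨⟨⟨hm, hm'⟩, hmm'⟩, hma⟩
      refine ⟨⟨hm, ?_⟩, ⟨hm', ?_⟩⟩
      · rw [hma, ha']
      · rw [← hmm', hma, ha']
  symm
  calc ∑ a ∈ range j, (∑ m ∈ (Ioc M (2 * M)).filter (fun m => m ≡ a [MOD j]), f m) *
          (∑ m ∈ (Ioc M (2 * M)).filter (fun m => m ≡ a [MOD j]), g m)
      = ∑ a ∈ range j, ∑ p ∈ ((Ioc M (2 * M)).filter (fun m => m ≡ a [MOD j])) ×ˢ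
            ((Ioc M (2 * M)).filter (fun m => m ≡ a [MOD j])), f p.1 * g p.2 := by
          refine sum_congr rfl fun a _ => ?_
          rw [sum_mul_sum, ← sum_product']
    _ = ∑ a ∈ range j, ∑ p ∈ (((Ioc M (2 * M) ×ˢ Ioc M (2 * M)).filter
            (fun p : ℕ × ℕ => p.1 ≡ p.2 [MOD j])).filter (fun p : ℕ × ℕ => p.1 % j = a)),
            f p.1 * g p.2 := by
          refine sum_congr rfl fun a ha => ?_
          rw [key a ha]
    _ = _ := by
          rw [sum_fiberwise_of_maps_to (fun p _ => mem_range.mpr (Nat.mod_lt _ hj))]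

/-- **STUB P3 · `stub_welchBound`** (FROBENIUS / WELCH, general real weights `F n` for a finite
family of rows `n ∈ 𝒩`): `(Σ_{n∈𝒩} V_n)² ≤ j · Σ_{n,n'∈𝒩} T_j(n,n')²`, where
`V_n = Σ_{a<j} (Σ_{m ∈ (M,2M], m ≡ a (j)} F n m)²` is the class variance and
`T_j(n,n') = Σ_{(m,m') ∈ (M,2M]², m ≡ m' (j)} F n m · F n' m'` is the coset sum (the Gram matrix
`(T_j(n,n'))_{n,n'}` is PSD of rank `≤ j`, so `‖G‖_F² ≥ (tr G)²/j`).  With `F n m = λ(mn+c)`,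
`V_n ≍ M` for all `n ≤ 2M` forces `max_{n≠n'} |T_j(n,n')| ≫ M^{3/4}`: the exponent `3/4` of the crux
cannot be lowered. [folklore; Welch 1974, doi:10.1109/TIT.1974.1055219] -/
theorem stub_welchBound :
    ∀ (F : ℕ → ℕ → ℝ) (M j : ℕ) (𝒩 : Finset ℕ), 1 ≤ j →
      (∑ n ∈ 𝒩, ∑ a ∈ Finset.range j,
          (∑ m ∈ (Finset.Ioc M (2 * M)).filter (fun m => m ≡ a [MOD j]), F n m) ^ 2) ^ 2
        ≤ (j : ℝ) * ∑ n ∈ 𝒩, ∑ n' ∈ 𝒩,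
            (∑ p ∈ (Finset.Ioc M (2 * M) ×ˢ Finset.Ioc M (2 * M)).filter
                (fun p : ℕ × ℕ => p.1 ≡ p.2 [MOD j]), F n p.1 * F n' p.2) ^ 2 := by
  intro F M j 𝒩 hj
  have h := welch_frobenius_trace_sq_le
    (fun n a => ∑ m ∈ (Ioc M (2 * M)).filter (fun m => m ≡ a [MOD j]), F n m) 𝒩 j
  refine h.trans (le_of_eq ?_)
  congr 1
  refine sum_congr rfl fun n _ => sum_congr rfl fun n' _ => ?_
  rw [welch_coset_eq_classInner (F n) (F n') M j hj]

end Summit.Parity.GeneralizedHardyLittlewood.Theorems.CosetDecorrelation.FareyLevelMeanCoupling
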